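import Mathlib
import Literature.Computability.Complexity.CliqueTestGraphs
import Summits.PneNP.PneNP.Theorems.ConvexRankGatesConvexGateBlindJuntaBlind

/-!
# PneNP / ConvexRankGates — `ConvexGateBlind`: the JUNTA-RESTRICTED canonical form of the crux holds (every `δ < 1/2`)

Helpers (`--supports stmt-PneNP-10680`), the asymptotic corollary of `…JuntaBlind.lean` in the currency of the canonical
form `convexGateBlind_iff_cliqueDistConeRankHard` (Theorems/…CanonicalForm.lean): the crux says that for some
`δ ∈ (0,1/2)` and every `c`, eventually in `m`, for every `ε > 0` there are no `H_u, Y_Q ⪰ 0`, `U, V ≥ 0` with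
`q + r ≤ m^c` and `cdist Q u - ε = tr(H_u Y_Q) + ∑_l U_{u,l} V_{l,Q}` for all `k`-sets `Q` (`k = ⌈m^δ⌉₊`) and all
`k`-clique-free `u`. THEOREM (`junta_cliqueDistConeRankHard`, registered stub `junta_crux`): for EVERY `δ ∈ (0,1/2)`,
eventually in `m`, for every `ε > 0`, this already fails — WITHOUT any bound on `q` or on the number of terms — as soon as
the ROW objects are juntas of size `≤ (k-1)/2`: `Y_Q = Y(Q ∩ S₀)` and `V_{l,Q} = G_l(Q ∩ S_l)` with `2 #S₀, 2 #S_l ≤ k - 1`.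
So the junta-restricted crux is TRUE, with the crux's own order of quantifiers (`m` first, then all `ε > 0`). Proof: inside
`Fin m` take the balanced complete `(k-1)`-partite graph on the first `(k-1)·⌊m/(k-1)⌋` vertices (isolated elsewhere;
`k`-clique-free), restrict the identity to the `k`-sets of that block (`padRow`/`padCol`/`cdist_pad` of
`…ExponentDown.lean` with no apex), pull the juntas back along the embedding, and apply `cdist_colorVec_not_juntaRep`;
`δ < 1/2` gives classes of size `⌊m/(k-1)⌋ ≥ k` eventually. [new]
-/

namespace Summit.PneNP.PneNP.Theorems

open Finset Filter Literature.Computability.Complexity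
open Summit.PneNP.PneNP.Cruxes.ConvexGateBlind.StrictRankConicCover (Edge cdist padRow padCol liveEmb apexSet
  cdist_pad cliqueFn_padCol card_padRow)

noncomputable section

/-! ## A balanced colouring of `Fin (K * n)` -/

/-- The balanced `K`-colouring of `Fin (K * n)` (class = first coordinate under `Fin K × Fin n ≃ Fin (K * n)`). -/
def balCol (K n : ℕ) : Fin (K * n) → Fin K := fun v => (finProdFinEquiv.symm v).1

/-- Every class of `balCol K n` has exactly `n` vertices. -/
theorem card_cls_balCol (K n : ℕ) (i : Fin K) : (cls (balCol K n) i).card = n := by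
  classical
  have hset : cls (balCol K n) i = (univ : Finset (Fin n)).map
      ⟨fun j => finProdFinEquiv (i, j), fun j j' hjj' => by simpa using hjj'⟩ := by
    ext v
    simp only [mem_cls, balCol, Finset.mem_map, Finset.mem_univ, true_and, Function.Embedding.coeFn_mk]
    constructor
    · intro hv
      refine ⟨(finProdFinEquiv.symm v).2, ?_⟩
      rw [← hv, Prod.mk.eta, Equiv.apply_symm_apply]
    · rintro ⟨j, rfl⟩
      rw [Equiv.symm_apply_apply]
  rw [hset, card_map, card_univ, Fintype.card_fin]

/-! ## Pulling a junta back along the embedding of the coloured block -/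

/-- With no apex, `padRow` is the plain embedding of the block. -/
theorem padRow_zero {M m : ℕ} (h : M + 0 ≤ m) (Q : Finset (Fin M)) : padRow h Q = Q.map (liveEmb h) := by
  rw [padRow]
  have : apexSet h = ∅ := by
    rw [apexSet, Finset.univ_eq_empty, Finset.map_empty]
  rw [this, Finset.union_empty]

/-- Intersecting the embedded block set with `S` = embedding the intersection with the pulled-back `S`. -/
theorem map_liveEmb_inter {M m : ℕ} (h : M + 0 ≤ m) (Q : Finset (Fin M)) (S : Finset (Fin m)) :
    Q.map (liveEmb h) ∩ S = (Q ∩ univ.filter fun v => liveEmb h v ∈ S).map (liveEmb h) := by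
  ext w
  rw [Finset.mem_inter, Finset.mem_map, Finset.mem_map]
  constructor
  · rintro ⟨⟨v, hv, hvw⟩, hw⟩
    refine ⟨v, Finset.mem_inter.2 ⟨hv, Finset.mem_filter.2 ⟨Finset.mem_univ _, ?_⟩⟩, hvw⟩
    rw [hvw]; exact hw
  · rintro ⟨v, hv, hvw⟩
    obtain ⟨hvQ, hvS⟩ := Finset.mem_inter.1 hv
    refine ⟨⟨v, hvQ, hvw⟩, ?_⟩
    rw [← hvw]; exact (Finset.mem_filter.1 hvS).2

/-- The pulled-back junta set is no larger. -/
theorem card_filter_liveEmb_mem_le {M m : ℕ} (h : M + 0 ≤ m) (S : Finset (Fin m)) :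
    (univ.filter fun v : Fin M => liveEmb h v ∈ S).card ≤ S.card := by
  refine Finset.card_le_card_of_injOn (liveEmb h) (fun v hv => (mem_filter.1 hv).2) ?_
  intro v _ v' _ hvv'
  exact (liveEmb h).injective hvv'

/-! ## Eventually `k = ⌈m^δ⌉₊ ≥ 3` and `k² ≤ m` -/

/-- For `0 < δ < 1/2`: eventually `3 ≤ ⌈m^δ⌉₊` and `⌈m^δ⌉₊ · ⌈m^δ⌉₊ ≤ m`. -/
theorem eventually_ceil_rpow_sq_le {δ : ℝ} (hδ0 : 0 < δ) (hδ : δ < 1 / 2) :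
    ∀ᶠ m : ℕ in atTop, 3 ≤ ⌈(m : ℝ) ^ δ⌉₊ ∧ ⌈(m : ℝ) ^ δ⌉₊ * ⌈(m : ℝ) ^ δ⌉₊ ≤ m := by
  have hx : Tendsto (fun m : ℕ => (m : ℝ) ^ δ) atTop atTop :=
    (tendsto_rpow_atTop hδ0).comp tendsto_natCast_atTop_atTop
  have hy : Tendsto (fun m : ℕ => (m : ℝ) ^ (1 - 2 * δ)) atTop atTop :=
    (tendsto_rpow_atTop (by linarith)).comp tendsto_natCast_atTop_atTop
  filter_upwards [hx.eventually_ge_atTop 3, hy.eventually_ge_atTop 4, eventually_ge_atTop 1] with m h3 h4 hm1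
  have hm0 : (0 : ℝ) < m := by exact_mod_cast (show 0 < m by omega)
  have hx0 : (0 : ℝ) ≤ (m : ℝ) ^ δ := by positivity
  constructor
  · exact_mod_cast h3.trans (Nat.le_ceil _)
  · have hceil : (⌈(m : ℝ) ^ δ⌉₊ : ℝ) ≤ (m : ℝ) ^ δ + 1 := (Nat.ceil_lt_add_one hx0).le
    have h1 : (m : ℝ) ^ δ + 1 ≤ 2 * (m : ℝ) ^ δ := by linarith
    have hsq : ((⌈(m : ℝ) ^ δ⌉₊ : ℝ)) * (⌈(m : ℝ) ^ δ⌉₊ : ℝ) ≤ 4 * ((m : ℝ) ^ δ * (m : ℝ) ^ δ) := by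
      have hc0 : (0 : ℝ) ≤ ⌈(m : ℝ) ^ δ⌉₊ := Nat.cast_nonneg _
      nlinarith
    have hpow : (m : ℝ) ^ δ * (m : ℝ) ^ δ * (m : ℝ) ^ (1 - 2 * δ) = m := by
      rw [← Real.rpow_add hm0, ← Real.rpow_add hm0]
      rw [show δ + δ + (1 - 2 * δ) = 1 by ring, Real.rpow_one]
    have hpow' : (m : ℝ) ^ (1 - 2 * δ) * ((m : ℝ) ^ δ * (m : ℝ) ^ δ) = m := by
      rw [mul_comm]; exact hpow
    have hmain : ((⌈(m : ℝ) ^ δ⌉₊ : ℝ)) * (⌈(m : ℝ) ^ δ⌉₊ : ℝ) ≤ m := by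
      calc ((⌈(m : ℝ) ^ δ⌉₊ : ℝ)) * (⌈(m : ℝ) ^ δ⌉₊ : ℝ) ≤ 4 * ((m : ℝ) ^ δ * (m : ℝ) ^ δ) := hsq
        _ ≤ (m : ℝ) ^ (1 - 2 * δ) * ((m : ℝ) ^ δ * (m : ℝ) ^ δ) :=
            mul_le_mul_of_nonneg_right h4 (by positivity)
        _ = m := hpow'
    exact_mod_cast hmain

/-! ## The junta-restricted canonical form holds -/

/-- **The junta-restricted crux is true (every `δ ∈ (0,1/2)`).** Eventually in `m`, for every `ε > 0`, every PSD-valued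
`Y` and `H`, every `W, G ≥ 0` and all junta sets with `2 #S₀ ≤ k - 1`, `2 #S_l ≤ k - 1` (`k = ⌈m^δ⌉₊`), the canonical
identity `cdist Q u - ε = tr(H_u Y(Q ∩ S₀)) + ∑_l W_{u,l} G_l(Q ∩ S_l)` fails for some `k`-set `Q` and some `k`-clique-free
`u` — with no bound on the PSD dimension `q` or on the number of terms. [new] -/
theorem junta_cliqueDistConeRankHard {δ : ℝ} (hδ0 : 0 < δ) (hδ : δ < 1 / 2) :
    ∀ᶠ m : ℕ in atTop, ∀ ε : ℝ, 0 < ε → ∀ (q : ℕ) (ι : Type) [Fintype ι] (S₀ : Finset (Fin m))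
      (S : ι → Finset (Fin m)), 2 * S₀.card ≤ ⌈(m : ℝ) ^ δ⌉₊ - 1 → (∀ l, 2 * (S l).card ≤ ⌈(m : ℝ) ^ δ⌉₊ - 1) →
      ∀ (H : (Edge m → Bool) → Matrix (Fin q) (Fin q) ℝ) (Y : Finset (Fin m) → Matrix (Fin q) (Fin q) ℝ)
        (W : (Edge m → Bool) → ι → ℝ) (G : ι → Finset (Fin m) → ℝ),
      (∀ u, cliqueFn m ⌈(m : ℝ) ^ δ⌉₊ u = false → (H u).PosSemidef) → (∀ P, (Y P).PosSemidef) →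
      (∀ u l, 0 ≤ W u l) → (∀ l P, 0 ≤ G l P) →
      ¬ ∀ (Q : Finset (Fin m)) (u : Edge m → Bool), Q.card = ⌈(m : ℝ) ^ δ⌉₊ → cliqueFn m ⌈(m : ℝ) ^ δ⌉₊ u = false →
          cdist Q u - ε = (H u * Y (Q ∩ S₀)).trace + ∑ l, W u l * G l (Q ∩ S l) := by
  filter_upwards [eventually_ceil_rpow_sq_le hδ0 hδ] with m hm
  obtain ⟨hk3, hkk⟩ := hm
  intro ε hε q ι _ S₀ S hS₀ hS H Y W G hH hY hW hG hall
  classical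
  -- sizes: `k = K + 1`, classes of size `n = m / K ≥ k`, block `M = K n ≤ m`
  set k : ℕ := ⌈(m : ℝ) ^ δ⌉₊ with hk
  set K : ℕ := k - 1 with hK
  have hkK : k = K + 1 := by omega
  have hK2 : 2 ≤ K := by omega
  set n : ℕ := m / K with hn
  have hKpos : 0 < K := by omega
  have hnk : K + 1 ≤ n := by
    rw [hn, Nat.le_div_iff_mul_le hKpos]
    calc (K + 1) * K ≤ k * k := by rw [hkK]; exact Nat.mul_le_mul_left _ (Nat.le_succ K)
      _ ≤ m := hkk
  set M : ℕ := K * n with hM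
  have hpad : M + 0 ≤ m := by rw [add_zero, hM, hn, mul_comm]; exact Nat.div_mul_le_self m K
  -- the coloured block and its column
  set hb : Fin M → Fin K := balCol K n with hhb
  have hbal : ∀ c, (cls hb c).card = n := card_cls_balCol K n
  set u₀ : Edge m → Bool := padCol (m := m) 0 (colorVec hb) with hu₀
  have hu₀free : cliqueFn m k u₀ = false := by
    have := cliqueFn_padCol hpad (K := K + 1) (by omega) (colorVec hb) (cliqueFn_colorVec hb (Nat.lt_succ_self K))
    rw [hkK]
    simpa using this
  -- the identity restricted to the block is a junta representation of `cdist · (colorVec hb) - ε`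
  let Sx : Option ι → Finset (Fin M) := fun o =>
    o.elim (univ.filter fun v => liveEmb hpad v ∈ S₀) (fun l => univ.filter fun v => liveEmb hpad v ∈ S l)
  let Fx : Option ι → Finset (Fin M) → ℝ := fun o P' =>
    o.elim ((H u₀ * Y (P'.map (liveEmb hpad))).trace) (fun l => W u₀ l * G l (P'.map (liveEmb hpad)))
  have hrep : ∀ Q' : Finset (Fin M), Q'.card = K + 1 → cdist Q' (colorVec hb) - ε = ∑ o, Fx o (Q' ∩ Sx o) := by
    intro Q' hQ'
    have hQ : (padRow hpad Q').card = k := by rw [card_padRow, hQ', hkK]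
    have h1 := hall (padRow hpad Q') u₀ hQ hu₀free
    rw [hu₀, cdist_pad hpad Q' (colorVec hb)] at h1
    rw [← hu₀] at h1
    rw [h1, Fintype.sum_option]
    simp only [Fx, Sx, Option.elim]
    rw [padRow_zero hpad, map_liveEmb_inter hpad Q' S₀]
    congr 1
    refine Finset.sum_congr rfl fun l _ => ?_
    rw [map_liveEmb_inter hpad Q' (S l)]
  refine cdist_colorVec_not_juntaRep hb (t := K / 2) hbal hK2 hnk (Nat.mul_div_le K 2) hε
    (ι := Option ι) Sx Fx ?_ ?_ hrep
  · intro o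
    cases o with
    | none =>
      show (univ.filter fun v => liveEmb hpad v ∈ S₀).card ≤ K / 2
      have := card_filter_liveEmb_mem_le hpad S₀
      rw [Nat.le_div_iff_mul_le (by norm_num)]
      omega
    | some l =>
      show (univ.filter fun v => liveEmb hpad v ∈ S l).card ≤ K / 2
      have := card_filter_liveEmb_mem_le hpad (S l)
      have h2 := hS l
      rw [Nat.le_div_iff_mul_le (by norm_num)]
      omega
  · intro o P'
    cases o with
    | none => exact Literature.Combinatorics.SimpleGraph.trace_mul_nonneg_of_posSemidef (hH u₀ hu₀free) (hY _)
    | some l => exact mul_nonneg (hW u₀ l) (hG l _)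

/-- **Registered helper stub (the junta-restricted crux holds).** Restatement of `junta_cliqueDistConeRankHard` with all
parameters explicit. -/
theorem junta_crux : ∀ (δ : ℝ), 0 < δ → δ < 1 / 2 → ∀ᶠ m : ℕ in Filter.atTop, ∀ ε : ℝ, 0 < ε → ∀ (q : ℕ) (ι : Type) [Fintype ι] (S₀ : Finset (Fin m)) (S : ι → Finset (Fin m)), 2 * S₀.card ≤ ⌈(m : ℝ) ^ δ⌉₊ - 1 → (∀ l, 2 * (S l).card ≤ ⌈(m : ℝ) ^ δ⌉₊ - 1) → ∀ (H : (Edge m → Bool) → Matrix (Fin q) (Fin q) ℝ) (Y : Finset (Fin m) → Matrix (Fin q) (Fin q) ℝ) (W : (Edge m → Bool) → ι → ℝ) (G : ι → Finset (Fin m) → ℝ), (∀ u, cliqueFn m ⌈(m : ℝ) ^ δ⌉₊ u = false → (H u).PosSemidef) → (∀ P, (Y P).PosSemidef) → (∀ u l, 0 ≤ W u l) → (∀ l P, 0 ≤ G l P) → ¬ ∀ (Q : Finset (Fin m)) (u : Edge m → Bool), Q.card = ⌈(m : ℝ) ^ δ⌉₊ → cliqueFn m ⌈(m : ℝ) ^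 δ⌉₊ u = false → cdist Q u - ε = (H u * Y (Q ∩ S₀)).trace + ∑ l, W u l * G l (Q ∩ S l) := by
  intro δ hδ0 hδ
  exact junta_cliqueDistConeRankHard hδ0 hδ

end

end Summit.PneNP.PneNP.Theorems
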